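import Literature.NumberTheory.Automorphic.Liu2021.AppendixC.Thm415Pinned
import HarnessLib

/-!
# Transport of the multiplicity space `Hom_{ℚ̄_ℓ[G]}(ι ∘ ρ, ℚ̄_ℓ ⊗ H¹_ét(tower))` along a Hecke-intertwining tower isomorphism

Topic `NumberTheory/Automorphic/Liu2021/AppendixC`; namespace `Literature.NumberTheory.Automorphic.Liu2021.AppendixC`.
GENERIC bookkeeping over ★ `Sec42Data.EtaleHeckeDatum.omegaHom` (`Thm415Pinned.lean`, [Liu2021, §4.3 l. 2162–2165]: the
`ℚ̄_ℓ`-module of `ι`-semilinear `G`-equivariant maps `W → ℚ̄_ℓ ⊗_{ℚ_ℓ} H¹_ét(A_∞)`): for two §4.2 data `C`, `C′` (possibly over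
different base-field data), étale Hecke data `X`, `X′`, representations `ρ` of `C.G` and `ρ′ = ρ ∘ θ` of `C′.G`, and a
`ℚ_ℓ`-linear ISOMORPHISM of towers `Ψ : H¹_ét(C) ≃ H¹_ét(C′)` with `Ψ ∘ X.rhoEt (θ g′) = X′.rhoEt g′ ∘ Ψ`:

* `rank_omegaHom_le_of_towerEquiv` — `f ↦ (Ψ ⊗ 1) ∘ f` injects `X.omegaHom ι ρ` into `X′.omegaHom ι ρ′`, so the `ℚ̄_ℓ`-rank does
  not increase;
* `rank_omegaHom_eq_of_towerEquiv` — with intertwining data in both directions the ranks are EQUAL.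

Sibling of ★ `omegaHomPull` (`OmegaHomPullback.lean`: pull-back along an `EtaleTowerHom` of a SUB-datum with INDUCED Hecke data, same
base fields) and of ★ `blockSet_eq_of_equiv` (`OmegaHomEquivTransport.lean`: isomorphisms of the SOURCE module `W`); here the TARGET towers
differ by an abstract `ℚ_ℓ`-linear isomorphism with an abstract intertwining hypothesis (the shape of the K2 transport, which is not a tower
morphism of Shimura data).

Consumer: the cell `hodgecm-mathlib`'s d6 line (crux `HLiu418`, stmt-HodgeConjecture-24832) compares the multiplicity space of one
`ℂ[U(J⋆)(𝔸_f)]`-module on the twisted record tower `X⋆` and on the untwisted `M⋆ = Sh(G,h)` through the ★ K2 transport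
(`Summits/…/HypLiu418/A3Liu418GSConjugateTransport.k2_towerEquiv`).  Theorems only; no `def`, no named fact, no `sorry`.
HC_CM is proved only modulo the 7 printed citations until rung 0 closes; nothing of [Liu2021] is asserted here.

## References
* [Liu2021] Y. Liu, *Fourier–Jacobi cycles and arithmetic relative trace formula*, Camb. J. Math. 9 (2021) = arXiv:2102.11518,
  §4.2 (l. 2053–2081), §4.3 (l. 2158–2168).
-/

set_option autoImplicit false

noncomputable section

open scoped TensorProduct
open NumberField

namespace Literature.NumberTheory.Automorphic.Liu2021.AppendixC

namespace Sec42Data.EtaleHeckeDatum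

variable {F E : Type} [Field F] [NumberField F] [IsTotallyReal F] [Field E] [NumberField E] [Algebra F E]
  [IsTotallyComplex E] [Algebra.IsQuadraticExtension F E]
  {F' E' : Type} [Field F'] [NumberField F'] [IsTotallyReal F'] [Field E'] [NumberField E'] [Algebra F' E']
  [IsTotallyComplex E'] [Algebra.IsQuadraticExtension F' E']
  {P5 : PropC5Data F E} {P5' : PropC5Data F' E'} {iso iso' : ℕ → Prop} {C : Sec42Data P5 iso} {C' : Sec42Data P5' iso'}
  {ℓ : ℕ} [Fact ℓ.Prime]

/-- **Transport of the multiplicity space along a Hecke-intertwining tower isomorphism does not increase the rank**: if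
`Ψ : H¹_ét(tower of C) ≃ H¹_ét(tower of C′)` carries `X.rhoEt (θ g′)` to `X′.rhoEt g′` for every `g′` and `ρ′ = ρ ∘ θ`, then
`f ↦ (Ψ ⊗ 1) ∘ f` is an injective `ℚ̄_ℓ`-linear map `Hom_{ℚ̄_ℓ[G]}(ι ∘ ρ, ℚ̄_ℓ ⊗ H¹(C)) → Hom_{ℚ̄_ℓ[G′]}(ι ∘ ρ′, ℚ̄_ℓ ⊗ H¹(C′))`, so
`rank (X.omegaHom ι ρ) ≤ rank (X′.omegaHom ι ρ′)`. [folklore] [cite: Liu2021, §4.3 (FJcycle.tex l. 2162–2165)] -/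
theorem rank_omegaHom_le_of_towerEquiv (X : C.EtaleHeckeDatum ℓ) (X' : C'.EtaleHeckeDatum ℓ)
    (ι : ℂ ≃+* AlgebraicClosure ℚ_[ℓ]) {W : Type} [AddCommGroup W] [Module ℂ W]
    (ρ : Representation ℂ C.G W) (ρ' : Representation ℂ C'.G W) (θ : C'.G → C.G) (hρ : ∀ g', ρ' g' = ρ (θ g'))
    (Ψ : C.etaleH1Tower ℓ ≃ₗ[ℚ_[ℓ]] C'.etaleH1Tower ℓ)
    (hΨ : ∀ (g' : C'.G) (y : C.etaleH1Tower ℓ), Ψ (X.rhoEt (θ g') y) = X'.rhoEt g' (Ψ y)) :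
    Module.rank (AlgebraicClosure ℚ_[ℓ]) ↥(X.omegaHom ι ρ) ≤ Module.rank (AlgebraicClosure ℚ_[ℓ]) ↥(X'.omegaHom ι ρ') := by
  let A := AlgebraicClosure ℚ_[ℓ]
  let Eq : A ⊗[ℚ_[ℓ]] C.etaleH1Tower ℓ ≃ₗ[A] A ⊗[ℚ_[ℓ]] C'.etaleH1Tower ℓ :=
    Ψ.baseChange ℚ_[ℓ] A (C.etaleH1Tower ℓ) (C'.etaleH1Tower ℓ)
  have hcomm : ∀ g', (Eq : A ⊗[ℚ_[ℓ]] C.etaleH1Tower ℓ →ₗ[A] A ⊗[ℚ_[ℓ]] C'.etaleH1Tower ℓ) ∘ₗ (X.rhoEt (θ g')).baseChange A =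
      (X'.rhoEt g').baseChange A ∘ₗ (Eq : A ⊗[ℚ_[ℓ]] C.etaleH1Tower ℓ →ₗ[A] A ⊗[ℚ_[ℓ]] C'.etaleH1Tower ℓ) := fun g' => by
    have hc : Ψ.toLinearMap ∘ₗ X.rhoEt (θ g') = X'.rhoEt g' ∘ₗ Ψ.toLinearMap := LinearMap.ext (hΨ g')
    have hbc := congrArg (LinearMap.baseChange A) hc
    rw [LinearMap.baseChange_comp, LinearMap.baseChange_comp] at hbc
    exact hbc
  have hmem : ∀ f ∈ X.omegaHom ι ρ,
      (Eq : A ⊗[ℚ_[ℓ]] C.etaleH1Tower ℓ →ₗ[A] A ⊗[ℚ_[ℓ]] C'.etaleH1Tower ℓ).comp f ∈ X'.omegaHom ι ρ' := by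
    intro f hf g' w
    have hfw : f (ρ (θ g') w) = (X.rhoEt (θ g')).baseChange A (f w) := hf (θ g') w
    simp only [LinearMap.coe_comp, Function.comp_apply, hρ g', hfw]
    exact LinearMap.congr_fun (hcomm g') (f w)
  let φ : ↥(X.omegaHom ι ρ) →ₗ[A] ↥(X'.omegaHom ι ρ') :=
    { toFun := fun f => ⟨(Eq : A ⊗[ℚ_[ℓ]] C.etaleH1Tower ℓ →ₗ[A] A ⊗[ℚ_[ℓ]] C'.etaleH1Tower ℓ).comp f.1, hmem f.1 f.2⟩
      map_add' := fun f g => Subtype.ext (LinearMap.ext fun w => by simp)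
      map_smul' := fun c f => Subtype.ext (LinearMap.ext fun w => by simp) }
  refine LinearMap.rank_le_of_injective φ fun f g hfg => Subtype.ext (LinearMap.ext fun w => Eq.injective ?_)
  exact LinearMap.congr_fun (congrArg Subtype.val hfg) w

/-- **Two-sided version: equal ranks.**  If, in addition, `ρ = ρ′ ∘ θ′` and `Ψ.symm` carries `X′.rhoEt (θ′ g)` to `X.rhoEt g`, the
two multiplicity spaces have the same `ℚ̄_ℓ`-rank. [folklore] [cite: Liu2021, §4.3 (FJcycle.tex l. 2162–2165)] -/
theorem rank_omegaHom_eq_of_towerEquiv (X : C.EtaleHeckeDatum ℓ) (X' : C'.EtaleHeckeDatum ℓ)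
    (ι : ℂ ≃+* AlgebraicClosure ℚ_[ℓ]) {W : Type} [AddCommGroup W] [Module ℂ W]
    (ρ : Representation ℂ C.G W) (ρ' : Representation ℂ C'.G W)
    (θ : C'.G → C.G) (hρ : ∀ g', ρ' g' = ρ (θ g')) (θ' : C.G → C'.G) (hρ' : ∀ g, ρ g = ρ' (θ' g))
    (Ψ : C.etaleH1Tower ℓ ≃ₗ[ℚ_[ℓ]] C'.etaleH1Tower ℓ)
    (hΨ : ∀ (g' : C'.G) (y : C.etaleH1Tower ℓ), Ψ (X.rhoEt (θ g') y) = X'.rhoEt g' (Ψ y))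
    (hΨ' : ∀ (g : C.G) (y' : C'.etaleH1Tower ℓ), Ψ.symm (X'.rhoEt (θ' g) y') = X.rhoEt g (Ψ.symm y')) :
    Module.rank (AlgebraicClosure ℚ_[ℓ]) ↥(X.omegaHom ι ρ) = Module.rank (AlgebraicClosure ℚ_[ℓ]) ↥(X'.omegaHom ι ρ') :=
  le_antisymm (rank_omegaHom_le_of_towerEquiv X X' ι ρ ρ' θ hρ Ψ hΨ)
    (rank_omegaHom_le_of_towerEquiv X' X ι ρ' ρ θ' hρ' Ψ.symm hΨ')

/-- **Symmetric intertwining from one-sided intertwining** when the two groups coincide along `θ′ ∘ θ`-free data: for a tower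
isomorphism `Ψ` with `Ψ (X.rhoEt (θ g′) y) = X′.rhoEt g′ (Ψ y)` one has `Ψ.symm (X′.rhoEt g′ y′) = X.rhoEt (θ g′) (Ψ.symm y′)`
(apply `Ψ`, use `Ψ ∘ Ψ.symm = id`). [folklore] [cite: Liu2021, §4.3 (FJcycle.tex l. 2158–2165)] -/
theorem towerEquiv_symm_rhoEt (X : C.EtaleHeckeDatum ℓ) (X' : C'.EtaleHeckeDatum ℓ) (θ : C'.G → C.G)
    (Ψ : C.etaleH1Tower ℓ ≃ₗ[ℚ_[ℓ]] C'.etaleH1Tower ℓ)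
    (hΨ : ∀ (g' : C'.G) (y : C.etaleH1Tower ℓ), Ψ (X.rhoEt (θ g') y) = X'.rhoEt g' (Ψ y))
    (g' : C'.G) (y' : C'.etaleH1Tower ℓ) :
    Ψ.symm (X'.rhoEt g' y') = X.rhoEt (θ g') (Ψ.symm y') :=
  (LinearEquiv.symm_apply_eq Ψ).2 (by rw [hΨ, LinearEquiv.apply_symm_apply])

end Sec42Data.EtaleHeckeDatum

end Literature.NumberTheory.Automorphic.Liu2021.AppendixC

end
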